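import Mathlib
import Summits.Parity.BatemanHorn.Theses.IsogenyRedei
import Summits.Parity.BatemanHorn.Theorems.IsogenyRedeiPolyMobiusTailStubEventuallyTwoLe
import Summits.Parity.BatemanHorn.Theorems.IsogenyRedeiPolyMobiusTailStubKernelFinOne
import Summits.Parity.BatemanHorn.Theorems.IsogenyRedeiPolyMobiusTailStubSignedTypeIOfKernel
import Summits.Parity.BatemanHorn.Theorems.IsogenyRedeiPolyMobiusTailStubStripFinOne
import Summits.Parity.BatemanHorn.Theorems.IsogenyRedeiPolyMobiusTailKernelTwoLe
import Summits.Parity.BatemanHorn.Theorems.IsogenyRedeiPolyMobiusTailStripTwoLe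
import Summits.Parity.BatemanHorn.Theorems.IsogenyRedeiPolyMobiusTailNaturalFormReductionAux
import Summits.Parity.BatemanHorn.Theorems.PolyMobiusTail.Negative.Structure
import Summits.Parity.BatemanHorn.Theorems.PolyMobiusTail.Negative.Equivalence
import Summits.Parity.BatemanHorn.Theorems.IsogenyRedeiTypeIMainTerm

/-!
# Crux `PolyMobiusTail` (stmt-Parity-0870), line `Sketch`: the reduction to natural form is EXACT

Lead prover `prover-line-stmt-Parity-0870-c1-0`.  With every theorem-grade piece of line `Sketch` in the tree
for every `k` — bridge 1 (pointwise `S`-expansion `stub_pointwise` + signed Type-I sums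
`stub_signedTypeI_of_kernel` over the kernel `stub_kernel_fin_one` / `stub_kernel_two_le`) and the strip
(`stub_strip_fin_one` / `stub_strip_two_le`) — and the Type-I main term proved (`typeIMainTerm_proof`,
stmt-Parity-0873), the crux is UNCONDITIONALLY EQUIVALENT to its natural form with a log cut-off:

`PolyMobiusTail ↔ ∀ BH systems f: Σ_{n≤x} Σ_{dᵢ∣fᵢ(n), ∏dᵢ > x/(log x)^{2k+2}} ∏ᵢ μ(dᵢ) log(fᵢ(n)/dᵢ) = o(x)`.

`→` of the natural form: `η = 3/4`, bridge 1 + strip, pointwise recombination; `←`: the crux holds at every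
`η ∈ (0,1)` (`Negative.polyMobiusTail_iff_forall_eta typeIMainTerm_proof`), subtract the two bridges.
So what is left of the crux after the line is EXACTLY its parity content, restated in natural form (the held
stub `stub_naturalLogTail` of the skeleton).  Everything here is proved. [folklore]
-/

open scoped BigOperators
open Filter Finset Polynomial Asymptotics

namespace Summit.Parity.BatemanHorn.Theorems.PolyMobiusTail.NaturalForm

open Literature.NumberTheory.Sieve

namespace Reduction

/-- The strip for every `k ≥ 1` (`stub_strip_fin_one`, `stub_strip_two_le`). -/
theorem strip_bound : ∀ (k : ℕ), 1 ≤ k → ∀ (f : Fin k → ℤ[X]),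
    Literature.NumberTheory.Sieve.IsBatemanHornSystem f → ∀ η : ℝ, 1 / 2 < η → η < 1 →
      (fun x : ℕ => ∑ n ∈ Finset.Icc 1 x,
        ((∑ d ∈ Fintype.piFinset (fun i => (((f i).eval (n : ℤ)).toNat).divisors),
            if (x : ℝ) ^ (1 - η) < ∏ i, (d i : ℝ) then
              ∏ i, ((ArithmeticFunction.moebius (d i) : ℝ) *
                Real.log ((((f i).eval (n : ℤ)).toNat : ℝ) / (d i : ℝ))) else 0)
        - (∑ d ∈ Fintype.piFinset (fun i => (((f i).eval (n : ℤ)).toNat).divisors),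
            if (x : ℝ) / Real.log x ^ (2 * k + 2) < ∏ i, (d i : ℝ) then
              ∏ i, ((ArithmeticFunction.moebius (d i) : ℝ) *
                Real.log ((((f i).eval (n : ℤ)).toNat : ℝ) / (d i : ℝ))) else 0)))
        =o[atTop] fun x : ℕ => (x : ℝ) := by
  intro k hk
  rcases k with _ | _ | k
  · omega
  · exact stub_strip_fin_one
  · exact stub_strip_two_le (k + 2) (by omega)

/-- **From the natural log tail to the crux** (`η = 3/4`): bridge 1 + strip + the hypothesis, recombined
pointwise in `n`. -/
theorem polyMobiusTail_of_naturalLogTail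
    (hLog : ∀ (k : ℕ) (f : Fin k → ℤ[X]), Literature.NumberTheory.Sieve.IsBatemanHornSystem f →
      (fun x : ℕ => ∑ n ∈ Finset.Icc 1 x,
        ∑ d ∈ Fintype.piFinset (fun i => (((f i).eval (n : ℤ)).toNat).divisors),
          if (x : ℝ) / Real.log x ^ (2 * k + 2) < ∏ i, (d i : ℝ) then
            ∏ i, ((ArithmeticFunction.moebius (d i) : ℝ) *
              Real.log ((((f i).eval (n : ℤ)).toNat : ℝ) / (d i : ℝ))) else 0)
        =o[atTop] fun x : ℕ => (x : ℝ)) :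
    Summit.Parity.BatemanHorn.Theses.IsogenyRedei.PolyMobiusTail := by
  intro k f hf
  rcases Nat.eq_zero_or_pos k with hk0 | hk
  · subst hk0
    exact Negative.polyMobiusTail_fin_zero f
  refine ⟨3 / 4, by norm_num, by norm_num, ?_⟩
  have e1 := stub_routeTailToNaturalTail k f hf (3 / 4) (by norm_num) (by norm_num)
  have e2 := strip_bound k hk f hf (3 / 4) (by norm_num) (by norm_num)
  have e3 := hLog k f hf
  have e := ((e1.add e2).add e3).const_mul_left ((-1 : ℝ) ^ k)
  refine e.congr' (Eventually.of_forall fun x => ?_) EventuallyEq.rfl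
  have hk : ((-1 : ℝ) ^ k) * ((-1 : ℝ) ^ k) = 1 := by
    rw [← mul_pow]; norm_num
  beta_reduce
  rw [← Finset.sum_add_distrib, ← Finset.sum_add_distrib, Finset.mul_sum]
  refine Finset.sum_congr rfl fun n _ => ?_
  generalize (∑ d ∈ Fintype.piFinset (fun i => (((f i).eval (n : ℤ)).toNat).divisors),
      if (x : ℝ) ^ (1 - 3 / 4 : ℝ) < ∏ i, (d i : ℝ) then
        ∏ i, ((ArithmeticFunction.moebius (d i) : ℝ) * Real.log (d i)) else 0) = R at *
  generalize (∑ d ∈ Fintype.piFinset (fun i => (((f i).eval (n : ℤ)).toNat).divisors),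
      if (x : ℝ) ^ (1 - 3 / 4 : ℝ) < ∏ i, (d i : ℝ) then
        ∏ i, ((ArithmeticFunction.moebius (d i) : ℝ) *
          Real.log ((((f i).eval (n : ℤ)).toNat : ℝ) / (d i : ℝ))) else 0) = A at *
  generalize (∑ d ∈ Fintype.piFinset (fun i => (((f i).eval (n : ℤ)).toNat).divisors),
      if (x : ℝ) / Real.log x ^ (2 * k + 2) < ∏ i, (d i : ℝ) then
        ∏ i, ((ArithmeticFunction.moebius (d i) : ℝ) *
          Real.log ((((f i).eval (n : ℤ)).toNat : ℝ) / (d i : ℝ))) else 0) = B at *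
  linear_combination R * hk


/-- **From the crux to the natural log tail**: the crux holds at every `η ∈ (0,1)` (Type-I main term),
take `η = 3/4` and subtract bridge 1 and the strip. -/
theorem naturalLogTail_of_polyMobiusTail (hCrux : Summit.Parity.BatemanHorn.Theses.IsogenyRedei.PolyMobiusTail) :
    ∀ (k : ℕ) (f : Fin k → ℤ[X]), Literature.NumberTheory.Sieve.IsBatemanHornSystem f →
      (fun x : ℕ => ∑ n ∈ Finset.Icc 1 x,
        ∑ d ∈ Fintype.piFinset (fun i => (((f i).eval (n : ℤ)).toNat).divisors),
          if (x : ℝ) / Real.log x ^ (2 * k + 2) < ∏ i, (d i : ℝ) then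
            ∏ i, ((ArithmeticFunction.moebius (d i) : ℝ) *
              Real.log ((((f i).eval (n : ℤ)).toNat : ℝ) / (d i : ℝ))) else 0)
        =o[atTop] fun x : ℕ => (x : ℝ) := by
  intro k f hf
  rcases Nat.eq_zero_or_pos k with hk0 | hk
  · subst hk0
    -- the empty system: the natural log tail is eventually `0`
    have hlog : ∀ᶠ x : ℝ in atTop, Real.log x ^ 2 ≤ 1 / 2 * x := by
      have h := (Real.isLittleO_pow_log_id_atTop (n := 2)).bound (by norm_num : (0 : ℝ) < 1 / 2)
      filter_upwards [h, eventually_ge_atTop (1 : ℝ)] with x hx hx1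
      simp only [id_eq, Real.norm_eq_abs, abs_of_nonneg (by positivity : (0 : ℝ) ≤ Real.log x ^ 2),
        abs_of_nonneg (by linarith : (0 : ℝ) ≤ x)] at hx
      exact hx
    refine (isLittleO_zero (fun x : ℕ => (x : ℝ)) atTop).congr' ?_ EventuallyEq.rfl
    filter_upwards [tendsto_natCast_atTop_atTop.eventually hlog,
      eventually_ge_atTop (3 : ℕ)] with x hx hx3
    symm
    refine Finset.sum_eq_zero fun n _ => Finset.sum_eq_zero fun d _ => ?_
    rw [if_neg]
    simp only [Finset.univ_eq_empty, Finset.prod_empty, not_lt, mul_zero, zero_add]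
    have hx1 : (1 : ℝ) < x := by exact_mod_cast (by omega : 1 < x)
    have hlogpos : 0 < Real.log x := Real.log_pos hx1
    rw [one_le_div (by positivity)]
    nlinarith
  have hT := (Negative.polyMobiusTail_iff_forall_eta Summit.Parity.BatemanHorn.Theorems.typeIMainTerm_proof).mp
    hCrux k f hf (3 / 4) (by norm_num) (by norm_num)
  have e1 := stub_routeTailToNaturalTail k f hf (3 / 4) (by norm_num) (by norm_num)
  have e2 := strip_bound k hk f hf (3 / 4) (by norm_num) (by norm_num)
  have e := ((hT.const_mul_left ((-1 : ℝ) ^ k)).sub e1).sub e2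
  refine e.congr' (Eventually.of_forall fun x => ?_) EventuallyEq.rfl
  beta_reduce
  rw [Finset.mul_sum, ← Finset.sum_sub_distrib, ← Finset.sum_sub_distrib]
  refine Finset.sum_congr rfl fun n _ => ?_
  ring

end Reduction

/-- **Stub `stub_naturalLogTail_iff_polyMobiusTail`** (registered auxiliary stub of line `Sketch`, the head of
this file): the crux `PolyMobiusTail` is unconditionally equivalent to its natural form with the log cut-off
`x/(log x)^{2k+2}` — the line's reduction is exact; what it leaves is the parity content and nothing else. [folklore] -/
theorem stub_naturalLogTail_iff_polyMobiusTail :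
    (∀ (k : ℕ) (f : Fin k → ℤ[X]), Literature.NumberTheory.Sieve.IsBatemanHornSystem f →
      (fun x : ℕ => ∑ n ∈ Finset.Icc 1 x,
        ∑ d ∈ Fintype.piFinset (fun i => (((f i).eval (n : ℤ)).toNat).divisors),
          if (x : ℝ) / Real.log x ^ (2 * k + 2) < ∏ i, (d i : ℝ) then
            ∏ i, ((ArithmeticFunction.moebius (d i) : ℝ) *
              Real.log ((((f i).eval (n : ℤ)).toNat : ℝ) / (d i : ℝ))) else 0)
        =o[atTop] fun x : ℕ => (x : ℝ))
    ↔ Summit.Parity.BatemanHorn.Theses.IsogenyRedei.PolyMobiusTail :=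
  ⟨Reduction.polyMobiusTail_of_naturalLogTail, Reduction.naturalLogTail_of_polyMobiusTail⟩

end Summit.Parity.BatemanHorn.Theorems.PolyMobiusTail.NaturalForm
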